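import Summits.QuantumFields.BalabanUV.Beta.GAN24.FibreRateMM
import Summits.QuantumFields.BalabanUV.Beta.GAN24.ClosedFormRateOfParts
import Summits.QuantumFields.BalabanUV.Beta.GAN24.KFibClosedBridge
import Summits.QuantumFields.BalabanUV.Beta.GAN24.FibreContinuity

/-!
# `BalabanUV.Beta.GAN24.FibreRateOfLegs` — binder row G-an2-4 / (CONV-C), road P1-fibre, leaf **P1-L11** `FibreRate` (Part B) AS A FUNCTION:
# shape (I2′) `RealRateK 3 Lc c (Lc⁻²)` from the three remaining unit-scaled leg rates (ff, fm, mf) — the mm leg, the bridge `kFib = kFibClosed` and `p = 0` discharged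

NOT IN PRINT; OUR PROOF ATTEMPT.  HONEST FRAMING (cell contract, verbatim): «discharging `BetaPertH` makes Bałaban's UV stability UNCONDITIONAL — a real
constructive-QFT result; it is NOT the continuum limit and NOT the Clay problem.»  HONEST DEPENDENCY (verbatim): «continuum YM on T⁴ ⇐ BetaPertH ∧ nine spine
estimates (0/9 proved); BetaPertH ⇐ (D1) ∧ (D4) ∧ CAP+tail; G-an2-4 gates asym, D1 and NE2/3/4.»  [folklore] assembly BY NAME of leaf-11's plug form
(`ClosedFormRateOfParts.norm_kFibClosed_succ_sub_le_of_parts`, Y11d), leaf-05's identification (`KFibClosedBridge.kFib_eq_kFibClosed`, L05b), leaf-08's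
closure lemma (`FibreContinuity.realRateK_of_eqOn_punctured`, Y09c) and this seat's mm leg (`FibreRateMM.mm_rate`, from the capacitance half); units
`CombesThomas.sfStep/smStep` BY NAME (TRIGGER-P1 c1/c2), constants symbolic (c3); no cited fact, no wall binder, no `def … : Prop` hypothesis (the three leg
rates are ORDINARY HYPOTHESES of the theorem, in the exact shapes of Y11d's plug — rows Y11r/Y11t*/PART C+F supply them); 1 `def` = explicit constant `cmm`.
NOT summit progress: `RealRateK` is ONE of the two shapes L12 needs ((I3′) = L10 is the other); NOTHING of (CONV-C)'s K-slot `ConvCK 3 Lc` is discharged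
here; 0 wall binders instantiated; NOT `BetaPertH`, NOT continuum, NOT Clay.

## What is proved (`d = 3`, every `Lc ≥ 1`)
* `cmm Lc = crPP 4·(4π²)²/Lc^{10}` and **`mm_rate_uniform`**: on `BZ ∖ {0}` the mm one-step difference (unit `smStep 3 Lc`) is `≤ cmm Lc·(Lc⁻²)^j`;
* **`realRateK_of_leg_rates`**: if for every `j`, every `q ∈ BZ 4 ∖ {0}` and all legs/offsets the ff, fm, mf unit-scaled one-step differences of T00's
  closed form (`AliasObjects.kFibClosed`, hypotheses `hff/hfm/hmf` = those of Y11d's plug with `sf := sfStep Lc`, `sm := smStep 3 Lc`) are bounded by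
  `c_ff·(Lc⁻²)^j`, `c_fm·(Lc⁻²)^j`, `c_mf·(Lc⁻²)^j`, then **`ConvCKOfShapes.RealRateK 3 Lc (c_ff + c_fm + c_mf + cmm Lc) (Lc⁻²)`** — literally shape (I2′).
So row L11 is DONE MODULO THREE LEG RATES (ff = T-share [leaf-11 Y11t*] + FEED-share, fm, mf = reading/source alias sums × the Cap⁻¹ blocks of PART C).

Unit `b2b-balaban-gan24-formalise-leaf-20` (G-an2-4 formalisation swarm, leaf prover 20), 2026-08-20.  Value = kernel assembly leaf toward the K-slot route P1,
NOT summit progress.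
-/

noncomputable section

open Complex Finset
open scoped BigOperators Real

namespace Summit.QuantumFields.BalabanUV.Beta.GAN24.FibreRateOfLegs

open Literature.MathematicalPhysics.QuantumFieldTheory.Balaban1983to89.B4Strip (ofRealVec)
open Literature.MathematicalPhysics.QuantumFieldTheory.King1986 (momSq momSq_nonneg)

/-! ## Row L11 as a FUNCTION of the three remaining leg rates (the mm leg is supplied here) -/

section Assembly
open Literature.MathematicalPhysics.QuantumFieldTheory.Balaban1983to89.B4ContourShift (BZ)
open Literature.MathematicalPhysics.QuantumFieldTheory.Balaban1983to89.Beta.OneStepResolventKernel (Fib)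
open AliasObjects (kFibClosed readW Ahat phiSol fhatF eVec)
open CombesThomas (sfStep smStep)
open ConvCKOfShapes (RealRateK)
open CapacitanceEndpointBlocks (gFac_pos)
open CapacitanceScalarRateSum (rateA)
open CapacitanceRateScaled (crPP rateA_nonneg momSq_le)
open FibreRateMM (mm_rate)

/-- [folklore] On the Brillouin zone `|p_i| ≤ π`. -/
theorem abs_le_pi_of_mem_BZ {D : ℕ} {p : Fin D → ℝ} (hp : p ∈ BZ D) (i : Fin D) : |p i| ≤ π := abs_le.2 ⟨hp.1 i, hp.2 i⟩

/-- [folklore] `0 ≤ crPP D`. -/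
theorem crPP_nonneg (D : ℕ) : 0 ≤ crPP D := by
  unfold crPP
  have := rateA_nonneg D
  have := gFac_pos D (by positivity : (0 : ℝ) ≤ D * π ^ 2)
  positivity

/-- The `q`-UNIFORM mm constant `cmm Lc = crPP 4·(4π²)²/Lc^{10}`. -/
def cmm (Lc : ℕ) : ℝ := crPP (3 + 1) * (4 * π ^ 2) ^ 2 / (Lc : ℝ) ^ 10

variable {Lc : ℕ} [NeZero Lc]

/-- **mm LEG, `q`-UNIFORM** [folklore]: on `BZ ∖ {0}` the mm one-step difference is `≤ cmm Lc · (Lc⁻²)^j`. -/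
theorem mm_rate_uniform (j : ℕ) {q : Fin (3 + 1) → ℝ} (hq : q ∈ BZ (3 + 1)) (hq0 : q ≠ 0) (κ l : Fin (3 + 1)) :
    ‖((smStep 3 Lc (j + 1) * smStep 3 Lc (j + 1) : ℝ) : ℂ) * phiSol (Lc ^ (j + 2)) (ofRealVec q) 0 (eVec l) κ
        - ((smStep 3 Lc j * smStep 3 Lc j : ℝ) : ℂ) * phiSol (Lc ^ (j + 1)) (ofRealVec q) 0 (eVec l) κ‖
      ≤ cmm Lc * (((Lc : ℝ) ^ 2)⁻¹) ^ j := by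
  have hq' := abs_le_pi_of_mem_BZ hq
  have hLc0 : (0 : ℝ) < Lc := by exact_mod_cast Nat.pos_of_ne_zero (NeZero.ne Lc)
  refine (mm_rate j hq' hq0 κ l).trans ?_
  unfold cmm
  have hP : momSq q ≤ 4 * π ^ 2 := by
    have h := momSq_le hq'
    norm_num at h
    linarith
  have hP0 : 0 ≤ momSq q := momSq_nonneg q
  have hc := crPP_nonneg (3 + 1)
  have h2 : momSq q ^ 2 ≤ (4 * π ^ 2) ^ 2 := pow_le_pow_left₀ hP0 hP 2
  have hθ : 0 ≤ (((Lc : ℝ) ^ 2)⁻¹) ^ j := by positivity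
  exact mul_le_mul_of_nonneg_right (div_le_div_of_nonneg_right (mul_le_mul_of_nonneg_left h2 hc) (by positivity)) hθ

/-- **ROW L11 = SHAPE (I2′) AS A FUNCTION OF THE THREE REMAINING UNIT-SCALED LEG RATES** [folklore] (`d = 3`, literal units `sfStep Lc`,
`smStep 3 Lc` BY NAME, rate `θ = Lc⁻²`): if the ff, fm and mf one-step differences of T00's closed form — EXACTLY the hypotheses `hff/hfm/hmf` of
`ClosedFormRateOfParts.norm_kFibClosed_succ_sub_le_of_parts`, quantified over `j` and the punctured zone — are `≤ c_ff·θ^j`, `≤ c_fm·θ^j`, `≤ c_mf·θ^j`,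
then `RealRateK 3 Lc (c_ff + c_fm + c_mf + cmm Lc) (Lc⁻²)`: the mm leg is `mm_rate_uniform`, the passage `kFibClosed ↦ kFib` is leaf-05's
`KFibClosedBridge.kFib_eq_kFibClosed`, the point `p = 0` is leaf-08's `FibreContinuity.realRateK_of_eqOn_punctured`. -/
theorem realRateK_of_leg_rates {cff cfm cmf : ℝ}
    (hff : ∀ (j : ℕ) (q : Fin (3 + 1) → ℝ), q ∈ BZ (3 + 1) → q ≠ 0 → ∀ (κ l : Fin (3 + 1)) (x' y' : Fin (3 + 1) → ℤ),
      ‖((sfStep Lc (j + 1) * sfStep Lc (j + 1) : ℝ) : ℂ) * ∑ m', readW (Lc ^ (j + 2)) (Lc ^ (j + 1)) (ofRealVec q) m' κ x' *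
          Ahat (Lc ^ (j + 2)) (ofRealVec q) (fhatF (Lc ^ (j + 2)) (Lc ^ (j + 1)) (ofRealVec q) l y') 0 m' κ -
        ((sfStep Lc j * sfStep Lc j : ℝ) : ℂ) * ∑ m, readW (Lc ^ (j + 1)) (Lc ^ j) (ofRealVec q) m κ x' *
          Ahat (Lc ^ (j + 1)) (ofRealVec q) (fhatF (Lc ^ (j + 1)) (Lc ^ j) (ofRealVec q) l y') 0 m κ‖ ≤ cff * (((Lc : ℝ) ^ 2)⁻¹) ^ j)
    (hfm : ∀ (j : ℕ) (q : Fin (3 + 1) → ℝ), q ∈ BZ (3 + 1) → q ≠ 0 → ∀ (κ l : Fin (3 + 1)) (x' : Fin (3 + 1) → ℤ),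
      ‖((sfStep Lc (j + 1) * smStep 3 Lc (j + 1) : ℝ) : ℂ) * ∑ m', readW (Lc ^ (j + 2)) (Lc ^ (j + 1)) (ofRealVec q) m' κ x' *
          Ahat (Lc ^ (j + 2)) (ofRealVec q) 0 (eVec l) m' κ -
        ((sfStep Lc j * smStep 3 Lc j : ℝ) : ℂ) * ∑ m, readW (Lc ^ (j + 1)) (Lc ^ j) (ofRealVec q) m κ x' *
          Ahat (Lc ^ (j + 1)) (ofRealVec q) 0 (eVec l) m κ‖ ≤ cfm * (((Lc : ℝ) ^ 2)⁻¹) ^ j)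
    (hmf : ∀ (j : ℕ) (q : Fin (3 + 1) → ℝ), q ∈ BZ (3 + 1) → q ≠ 0 → ∀ (κ l : Fin (3 + 1)) (y' : Fin (3 + 1) → ℤ),
      ‖((smStep 3 Lc (j + 1) * sfStep Lc (j + 1) : ℝ) : ℂ) *
          phiSol (Lc ^ (j + 2)) (ofRealVec q) (fhatF (Lc ^ (j + 2)) (Lc ^ (j + 1)) (ofRealVec q) l y') 0 κ -
        ((smStep 3 Lc j * sfStep Lc j : ℝ) : ℂ) * phiSol (Lc ^ (j + 1)) (ofRealVec q) (fhatF (Lc ^ (j + 1)) (Lc ^ j) (ofRealVec q) l y') 0 κ‖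
        ≤ cmf * (((Lc : ℝ) ^ 2)⁻¹) ^ j) :
    RealRateK 3 Lc (cff + cfm + cmf + cmm Lc) (((Lc : ℝ) ^ 2)⁻¹) := by
  refine FibreContinuity.realRateK_of_eqOn_punctured (fun j a x' b y' p => kFibClosed Lc (sfStep Lc) (smStep 3 Lc) j a x' b y' p)
    (fun j x' y' a b p hp hp0 => KFibClosedBridge.kFib_eq_kFibClosed (sfStep Lc) (smStep 3 Lc) j a x' b y' hp hp0) ?_
  intro j x' y' a b p hp hp0
  have h0ff : 0 ≤ cff * (((Lc : ℝ) ^ 2)⁻¹) ^ j := (norm_nonneg _).trans (hff j p hp hp0 0 0 0 0)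
  have h0fm : 0 ≤ cfm * (((Lc : ℝ) ^ 2)⁻¹) ^ j := (norm_nonneg _).trans (hfm j p hp hp0 0 0 0)
  have h0mf : 0 ≤ cmf * (((Lc : ℝ) ^ 2)⁻¹) ^ j := (norm_nonneg _).trans (hmf j p hp hp0 0 0 0)
  have h0mm : 0 ≤ cmm Lc * (((Lc : ℝ) ^ 2)⁻¹) ^ j := (norm_nonneg _).trans (mm_rate_uniform j hp hp0 0 0)
  have h := ClosedFormRateOfParts.norm_kFibClosed_succ_sub_le_of_parts Lc (sfStep Lc) (smStep 3 Lc) j p h0ff h0fm h0mf h0mm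
    (hff j p hp hp0) (hfm j p hp hp0) (hmf j p hp hp0) (fun κ l => mm_rate_uniform j hp hp0 κ l) a x' b y'
  refine h.trans (le_of_eq ?_)
  ring

end Assembly

end Summit.QuantumFields.BalabanUV.Beta.GAN24.FibreRateOfLegs

end
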